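import Summits.QuantumFields.YangMills.Theorems.BalabanUVNodesK0AxTangentSocketOnto
import Summits.QuantumFields.YangMills.Theorems.BalabanUVNodesN07WAnalyticTokOfSectC
import HarnessLib

/-!
# NODE O · K0ᴬ — THE (R-a) ROAD AT THE SCHEME OF RECORD WITH ITS TWO ANALYTIC LETTERS SUPPLIED: ✓`rootedReceipts_of_tokens_atScale_recordScheme` (★★★★, `S = bgSchemeOfRecord F 2 K (k+1) Ω 1 …`)
# displays `hWtok : WAnalyticTok …` and `htok : ∀ᶠ B in 𝓝 0, S.LieTokAt (W_B)`; the N07 width seat's reality ∕ trace programme (✓p822030 … ✓p825786) and ✓`wAnalyticTok_of_sectCRegime` replace BOTH by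
# ONE displayed Sect. C package — `Regime H♭ 0 C^{𝔰𝔩} b 0 C₂ c₄ 0 a_C ε_C`, `Prop4Hyp C^{𝔰𝔩} C₂ c₄`, `a₃ ≤ a_C`, `hCreal`, `hCtr` — plus the `G′` row and `Delta2Tok ∧ Delta2SymmTok` for the (3.134) datum
# ([15] Prop. 4 p. 292, Prop. 6 p. 295, (15) p. 280, Prop. 9 p. 309; [B9] (3.134) p. 422; [I] p. 264)

Cell `pub-ymgap`, width seat `pub-ymgap-dag-n07-w3` (g27), CLAIM-11 — a BY-NAME KNIT, `--kind proof --supports stmt-QuantumFields-27238 --as helper`; count-neutral.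
[15] = [Balaban1985Variational]; [B9] = [Balaban1985BackgroundPropagators]; [I] = [Balaban1987RG1].

CONTENTS.  ★★★ `rootedReceipts_of_tokens_atScale_recordScheme_of_sectC` — the binders of ✓`rootedReceipts_of_tokens_atScale_recordScheme` VERBATIM except that `hWtok`, `htok` are replaced by the Sect. C
package, the `G′` row (`G′` real and commuting with the scalar part) and `Delta2Tok ∧ Delta2SymmTok`; same conclusion (the four rooted receipts for every `(a, l)` and `TokP9reg♭ᵣ`).

HONEST LABELS.  One application of the cited theorem; N07's KNIT tokens (`Kc range covers sol_of_isMinOn star_mem star_isMinOn`), Prop. 6's `RegimeTok`, Sect. C's regime ∕ `Prop4Hyp` ∕ `hCreal` ∕ `hCtr`,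
`0 < a`, `dom ∈ 𝓝 1`, the chart letter and the dictionaries (J-crit′)∕(J-cons′) stay DISPLAYED — all of Bałaban's estimates among them; `N = 2`; K0ᴬ NOT closed; N07 NOT discharged; P0 ⟨26900⟩ OPEN;
R4 is the conditional finite-𝕋⁴ rung only.  Nothing here is a claim about the Yang–Mills mass gap (`Summit.QuantumFields`): finite torus, fixed `ε`; nothing continuum ∕ OS ∕ Clay.
-/

set_option autoImplicit false

noncomputable section

open Filter Topology
open scoped BigOperators Matrix.Norms.L2Operator InnerProductSpace

namespace Summit.QuantumFields.YangMills.Theorems.K0AxTangentSocketOntoOfSectC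

open Literature.MathematicalPhysics.QuantumFieldTheory.Balaban1983to89
open Literature.MathematicalPhysics.QuantumFieldTheory.Balaban1983to89.T4Continuum (T4Family)
open Literature.MathematicalPhysics.QuantumFieldTheory.Balaban1983to89.Node00
open B12GaugeOrbits021 (OrbitRel)
open B11Prop6Scheme (mapT Prop4Hyp)
open B11Eq174Chart (Regime)
open B9Eq311TracePairing (starW)
open B11Eq103H1Complex (BondL2K SiteL2K)
open B11Eq111FrakG (nabla115)
open B11Eq115Space (NegSize NegSup levWeight JetSup)
open B15DeterminingSets (MSField avgFamily atScale)
open NormedSpace (exp)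
open Summit.QuantumFields.YangMills.Theorems.K0RecordFormatNames
open Summit.QuantumFields.YangMills.Theorems.K0AxRootGrad
open Summit.QuantumFields.YangMills.Theorems.K0AxCtabUniq
open Summit.QuantumFields.YangMills.Theorems.N07TraceSectorDefs (scalPartW)
open Summit.QuantumFields.YangMills.Theorems.N07WAnalyticTokOfSectC (wAnalyticTok_of_sectCRegime)
open Summit.QuantumFields.YangMills.Theorems.N07LieTokAtUnitFieldTwo (eventually_lieTokAt_unitField_ofRecord_two_of_tok)

variable (F : T4Family) (θ : Stage13Params F 2)

set_option maxHeartbeats 1600000 in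
/-- ★★★ **THE (R-a) ROAD AT THE SCHEME OF RECORD, ANALYTIC LETTERS SUPPLIED** (`S = bgSchemeOfRecord F 2 K (k+1) Ω 1 dom levB G′ Δ2 a hposπ hpos♭ hQ ε_C B₀ C₄ a₃ j a𝔄 ε₄`, `k + 2 ≤ m + K`):
✓`rootedReceipts_of_tokens_atScale_recordScheme` with `hWtok := wAnalyticTok_of_sectCRegime …` and `htok := eventually_lieTokAt_unitField_ofRecord_two_of_tok …`.  DISPLAYED: N07's KNIT tokens;
`RegimeTok`; Sect. C's `Regime H♭ 0 C^{𝔰𝔩} b 0 C₂ c₄ 0 a_C ε_C`, `Prop4Hyp`, `a₃ ≤ a_C`, `hCreal`, `hCtr`; the `G′` row; `Delta2Tok ∧ Delta2SymmTok`; `0 < a`; `dom ∈ 𝓝 1`; the chart letter;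
(J-crit′), (J-cons′).  ⟹ (∀ a l, the four rooted receipts) ∧ TokP9reg♭ᵣ. [cite: Balaban1985Variational, Prop. 4 p.292, Prop. 6 (115)–(121) p.295, Prop. 9 p.309, (15) p.280, (19)–(20) p.281;
Balaban1985BackgroundPropagators, (3.134) p.422; Balaban1987RG1, p.264; Balaban1988Convergent, (2.10)–(2.13) pp.256–257] -/
theorem rootedReceipts_of_tokens_atScale_recordScheme_of_sectC (k K : ℕ) (hk2 : k + 2 ≤ (F.P K).m + (F.P K).K)
    [Fact (0 < (F.L : ℝ))] [Fact (0 < (F.P K).eta (k + 1))] [Fact (0 < c0Rec F K (k + 1))] [Fact (∀ c, 0 < wBRec F K (k + 1) c)]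
    (Ω : ℕ → Set (Site (F.P K) 0)) (dom : Set (GaugeField (F.P K) (k + 1) (SU 2))) (levB : PBond (F.P K) (k + 1) → ℕ)
    (Gp : SiteL2K ℂ (F.P K).d (fun _ => (F.P K).sitesPerDir 0) (c0Rec F K (k + 1)) (WRec 2) →ₗ[ℂ]
      SiteL2K ℂ (F.P K).d (fun _ => (F.P K).sitesPerDir 0) (c0Rec F K (k + 1)) (WRec 2))
    (Δ2 : BondL2K ℂ (F.P K).d (fun _ => (F.P K).sitesPerDir 0) (c0Rec F K (k + 1)) (WRec 2) →ₗ[ℂ]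
      BondL2K ℂ (F.P K).d (fun _ => (F.P K).sitesPerDir 0) (c0Rec F K (k + 1)) (WRec 2)) (a : ℝ)
    (hposπ : ∀ x, x ≠ 0 → 0 < RCLike.re ⟪x, laplaceAOfRecordAt F 2 (k + 1) (1 : GaugeField (F.P K) 0 (SU 2))
      (hessOpOfRecord128 F 2 (k + 1) (1 : GaugeField (F.P K) 0 (SU 2)) Gp (QflatOfRecord F 2 (k + 1)) Δ2)
      (QOfRecord F 2 (k + 1) (1 : GaugeField (F.P K) 0 (SU 2))) (QflatOfRecord F 2 (k + 1)) a x⟫_ℂ)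
    (hposb : ∀ x, x ≠ 0 → 0 < RCLike.re ⟪x, laplaceAOfRecord F 2 (k + 1) (1 : GaugeField (F.P K) 0 (SU 2))
      (QOfRecord F 2 (k + 1) (1 : GaugeField (F.P K) 0 (SU 2))) (QflatOfRecord F 2 (k + 1)) a x⟫_ℂ)
    (hQ : Function.Surjective (QOfRecord F 2 (k + 1) (1 : GaugeField (F.P K) 0 (SU 2)))) (εC B₀ C₄ a₃ j a𝔄 ε₄ : ℝ)
    (S : BgSchemeOnLit F 2 K (k + 1) Ω 1) (hS : S = bgSchemeOfRecord F 2 K (k + 1) Ω 1 dom levB Gp Δ2 a hposπ hposb hQ εC B₀ C₄ a₃ j a𝔄 ε₄)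
    (hT : S.RegimeTok) (ha𝔄 : 0 < a𝔄)
    -- the Sect. C package and the data rows replacing `hWtok`, `htok`
    {b C₂ c₄ aC : ℝ} (RC : Regime (H1OfRecordAtBgFlat F 2 K (k + 1) Ω 1 levB a hposb hQ) 0 (CslOfRecord F 2 K (k + 1) Ω 1 levB) b 0 C₂ c₄ 0 aC εC)
    (hP : Prop4Hyp (CslOfRecord F 2 K (k + 1) Ω 1 levB) C₂ c₄) (haC : a₃ ≤ aC)
    (hCreal : ∀ A : Space115Lit F 2 K (k + 1) Ω 1,
      ((JetSup.equiv _ _ (nabla115 ((F.P K).eta (k + 1)) (unitsOfRecord F 2 (1 : GaugeField (F.P K) 0 (SU 2))))).symm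
          (star (JetSup.equiv _ _ (nabla115 ((F.P K).eta (k + 1)) (unitsOfRecord F 2 (1 : GaugeField (F.P K) 0 (SU 2)))) A)) : Space115Lit F 2 K (k + 1) Ω 1) = A →
      ‖A‖ ≤ εC + aC → ((NegSup.equiv _ _).symm (star (NegSup.equiv _ _ (CslOfRecord F 2 K (k + 1) Ω 1 levB A))) :
        NegSize (F.L : ℝ) ((F.P K).eta (k + 1)) levB 0 (Matrix (Fin 2) (Fin 2) ℂ)) = CslOfRecord F 2 K (k + 1) Ω 1 levB A)
    (hCtr : ∀ A : Space115Lit F 2 K (k + 1) Ω 1,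
      ((JetSup.equiv _ _ (nabla115 ((F.P K).eta (k + 1)) (unitsOfRecord F 2 (1 : GaugeField (F.P K) 0 (SU 2))))).symm
          (star (JetSup.equiv _ _ (nabla115 ((F.P K).eta (k + 1)) (unitsOfRecord F 2 (1 : GaugeField (F.P K) 0 (SU 2)))) A)) : Space115Lit F 2 K (k + 1) Ω 1) = A →
      (∀ b', (JetSup.equiv _ _ (nabla115 ((F.P K).eta (k + 1)) (unitsOfRecord F 2 (1 : GaugeField (F.P K) 0 (SU 2)))) A b').trace = 0) →
      ‖A‖ ≤ εC + aC → ∀ c, (NegSup.equiv _ _ (CslOfRecord F 2 K (k + 1) Ω 1 levB A) c).trace = 0)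
    (hGpR : ∀ s, Gp (starW (phiRec 2) s) = starW (phiRec 2) (Gp s)) (hGpS : ∀ s, Gp (scalPartW 2 _ s) = scalPartW 2 _ (Gp s))
    (hΔ : Delta2Tok F 2 K (k + 1) Ω 1 levB a hposb hQ Δ2) (hs : Delta2SymmTok F 2 K (k + 1) Ω 1 Δ2)
    -- the remaining displayed letters, verbatim
    (hd : dom ∈ 𝓝 (1 : GaugeField (F.P K) (k + 1) (SU 2)))
    (hρ : letI := θ.instVβ₁; letI := θ.instVβ₂; ∀ v : θ.Vβ, NormedSpace.exp (θ.ρ8 v) ∈ Matrix.specialUnitaryGroup (Fin 2) ℂ)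
    (Kc : GaugeField (F.P K) (k + 1) (SU 2) → Set (Space115Lit F 2 K (k + 1) Ω 1))
    (range : ∀ V ∈ S.dom, ∀ A ∈ Kc V, S.chart V A ∈ bgReg F 2 K (k + 1) θ.εbg ∧ Averaging.iter (avOfRecord F 2 K) (k + 1) (S.chart V A) = V)
    (covers : ∀ V ∈ S.dom, ∀ U : GaugeField (F.P K) 0 (SU 2), U ∈ bgReg F 2 K (k + 1) θ.εbg →
      Averaging.iter (avOfRecord F 2 K) (k + 1) U = V → ∃ A ∈ Kc V, OrbitRel (k + 1) (S.chart V A) U)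
    (sol_of_isMinOn : ∀ V ∈ S.dom, ∀ A ∈ Kc V, IsMinOn (wilsonAction4 ∘ S.chart V) (Kc V) A →
      ‖A‖ ≤ S.ε₄ ∧ mapT (S.𝒢 V) 0 (S.W V) (S.J V) (S.𝔄 V) A = A)
    (star_mem : ∀ V ∈ S.dom, S.sol V ∈ Kc V) (star_isMinOn : ∀ V ∈ S.dom, IsMinOn (wilsonAction4 ∘ S.chart V) (Kc V) (S.sol V))
    (Jcrit : FlatCritDictionary F k K (msChart F 2 K (k + 1) (atScale (k + 1)) (avgFamily (avOfRecord F 2 K) 1) (1 : GaugeField (F.P K) 0 (SU 2))))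
    (Jcons : FlatConsDictionary F θ k K (msChart F 2 K (k + 1) (atScale (k + 1)) (avgFamily (avOfRecord F 2 K) 1) (1 : GaugeField (F.P K) 0 (SU 2)))
      (fun B => msChart F 2 K (k + 1) (atScale (k + 1)) (avgFamily (avOfRecord F 2 K) 1) (1 : GaugeField (F.P K) 0 (SU 2)) (S.lieExpo (unitField F θ k K B)))) :
    (∀ (a : θ.ιβ) (l : RespLabel F k K),
      RootedResponseCriticalModGaugeAt F θ k K a l ∧ RootedResponseOrbitAt F θ k K a l ∧
        RootedResponseInvCriticalAt F θ k K a l ∧ RootedResponseConstraintModGaugeAt F θ k K a l) ∧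
    letI := θ.instVβ₁; letI := θ.instVβ₂
    ContDiffAt ℝ 2 (fun B : Fin (F.P K).d → Site (F.P K) (k + 1) → θ.Vβ =>
      fun (b : PBond (F.P K) 0) (i i' : Fin 2) => ((recordBgField F θ k K B b : SU 2) : Matrix (Fin 2) (Fin 2) ℂ) i i') 0 := by
  have hWtok : WAnalyticTok F 2 K (k + 1) Ω 1 levB Gp a hposb hQ εC a₃ := wAnalyticTok_of_sectCRegime F 2 K (k + 1) Ω 1 levB Gp a hposb hQ εC a₃ RC hP haC
  have htok : letI := θ.instVβ₁; letI := θ.instVβ₂;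
      ∀ᶠ B in 𝓝 (0 : Fin (F.P K).d → Site (F.P K) (k + 1) → θ.Vβ), S.LieTokAt (unitField F θ k K B) := by
    subst hS
    have hT' : (bgSchemeOfRecord F 2 K (k + 1) Ω 1 dom levB Gp Δ2 a hposπ hposb hQ εC B₀ C₄ a₃ j a𝔄 ε₄).RegimeTok := hT
    exact eventually_lieTokAt_unitField_ofRecord_two_of_tok F θ k K Ω dom levB a hposπ hposb hQ εC B₀ C₄ a₃ j a𝔄 ε₄ RC hCreal hCtr hGpR hGpS hΔ hs hP haC hT' hd hρ
  exact rootedReceipts_of_tokens_atScale_recordScheme F θ k K hk2 Ω dom levB Gp Δ2 a hposπ hposb hQ εC B₀ C₄ a₃ j a𝔄 ε₄ S hS hT hWtok ha𝔄 hd hρ Kc range covers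
    sol_of_isMinOn star_mem star_isMinOn htok Jcrit Jcons

end Summit.QuantumFields.YangMills.Theorems.K0AxTangentSocketOntoOfSectC

end
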